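/-
# `Balaban1983to89.B5Eq125OfRecord` — Bałaban CMP 95 (1984): the factor estimates (1.125), (1.129), (1.130) of the random walk
# HYPOTHESIS-FREE FOR THE G-FAMILY OF RECORD (the (1.115)–(1.117) inputs discharged by the tree's theorem)

statement-level skeleton of published theorems with citation tags; proofs where landed; nothing here is a claim
about the Yang–Mills mass gap

CITATION HEADER (lean-in-tree rule).  Cell `lit-balaban`, unit `lit-balaban-r02` (reader/typer r02 gen 12 = fold owner of block B5),
HOME `run/shared/lean/pub/lit-balaban/` (SKELETON rows B5.Eq1.125 / B5.Eq1.130 cells — theorems of record for the displays; B5.Prop1.2 cell;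
S1-torus programme `lit-balaban-r02/B5-CLOSURE.md`).  B5 = T. Bałaban, *Propagators and renormalization transformations for lattice gauge
theories. I*, Commun. Math. Phys. **95** (1984) 17–40 [`Balaban1984PropagatorsI`], held as `paper:balaban1984-cmp95-propagators-rt-i`
(p. 38 = text layer p0022, p. 36 = p0020).  INPUTS, BY NAME (nothing restated): p38 gen 8's `B5SupFactor125Torus.{quotH_gz_G_le, abs_gz_G_le,
last_vec_le, last_ten_le, one_quotH_ten_le}` (p319659: the displays for `G = Δ_a⁻¹` of record, read at one pair / one point, from the TYPED
(1.115)–(1.117) `B5.Global115_117` of the instance) and the tree's `B5Prop12GHolds.global115_117_famG_printed` ((1.115)–(1.117) for the family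
of record `B5Prop12GLattice.famG d L a`, uniform constants).  Twin of own `B5Eq128OfRecord` (p319238, the same discharge for (1.128)).

WHAT IS PRINTED.  p. 38 [PDF 22] L2–5, verbatim: «The factors with G are estimated by using (1.115). For the first factor we have
‖ζ∇h_zGh_zA‖_α ≤ O(1)(‖ζ‖_α + |ζ|)|h_zA|. (1.125)»; p. 38: «The last factor in each term is estimated by using (1.115), (1.116)
|∇Gh_z∇*J| + |Gh_z∇*J| ≤ O(1)(‖J‖_ε + |J|) ≤ O(1)(‖J‖_{α+ε} + |J|). (1.129)  There is one possibility left yet, namely that of the terms with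
one factor. Then we apply the inequality (1.117) together with (1.115), (1.116) and we get ‖ζ∇h_zGh_z∇*J‖_α ≤ O(1)(‖ζ‖_α + |ζ|)(‖J‖_{α+ε} + |J|).
(1.130)»; p. 36 [PDF 20] (1.115)–(1.117).

WHAT THIS MODULE PROVES (kernel-checked, zero sorry; theorems only) — for B5's top-level family of record `famG d L a` (`d ≥ 1`, `L` odd `> 1`,
`a > 0`; member `i` = the real setting `latticeSettingP12R (nP i.P) (MP i.P) a i.P.K` on `T_η × {1..d}`, `η = L^{−K}`), with constants
`C > 0`, `C_α`, `C_ε`, `C_{α,ε}` UNIFORM OVER THE FAMILY and NO hypothesis on the instance: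
§1 **(1.125) of record** `eq125_of_record`: for every member, cube scale `M₀ ≥ 1`, centre `z`, real field `B`, `0 ≤ α < 1`, cut-off `ζ`,
   indices `ν, μ` and pair `0 < |x − x′| ≤ 1`:
   `|ζ(x′)(∇_ν h_zGB)_μ(x′) − ζ(x)(∇_ν h_zGB)_μ(x)| ≤ cFH(d)·(C + |C_α(α)|)·(‖ζ‖_α + |ζ|)·‖B‖·|x − x′|^α` (and the point form
   `|(h_zGB)(b)| ≤ C‖B‖`, `eq125_eval_of_record`);
§2 **(1.129) of record** `eq129_vec_of_record` (`|∇Gh_zJ| + |Gh_zJ| ≤ 2C|J|`) and `eq129_ten_of_record`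
   (`|∇Gh_z∇*T| + |Gh_z∇*T| ≤ cLT(d)·(C + |C_ε(ε)|)·(‖T‖_ε + |T|)`, `0 < ε < 1`);
§3 **(1.130) of record** `eq130_of_record`: `|ζ(x′)(∇_ν h_zGh_z∇*T)_μ(x′) − ζ(x)(∇_ν h_zGh_z∇*T)_μ(x)|
   ≤ c1H(d)·(C + |C_α(α)| + |C_ε(ε)| + |C_{α,ε}(α,ε)|)·(‖ζ‖_α + |ζ|)·(‖T‖_{α+ε} + |T|)·|x − x′|^α` (`0 ≤ α`, `0 < ε`, `α + ε < 1`).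

HONEST SCOPE.  (1) No new estimate: each theorem is p38 gen 8's pair/point reading composed with the tree's family-level (1.115)–(1.117)
(`global115_117_famG_printed`, itself obtained in the tree from `B5Prop12GHolds.prop12_famG_printed` — the alternative Combes–Thomas route —
exactly as p. 38 uses (1.115)–(1.117) as inputs here).  (2) Read at one pair / one point (the seminorm-level displays are the suprema of
these); constants ours (`cFH`, `cLT`, `c1H` d-only; `C`, `C_α`, `C_ε`, `C_{α,ε}` those of the family's (1.115)–(1.117)), uniform in the
member (`η`, volume, `K`) and in `M₀ ≥ 1`.  (3) Direct walk only; the adjoint sources of p. 39 are p38's `B5SupFactor129AdjTorus`.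
(4) Value = the three printed displays as closed kernel theorems for Bałaban's `G = Δ_a⁻¹`; NOT summit progress.
-/
import Mathlib
import Literature.MathematicalPhysics.QuantumFieldTheory.Balaban1983to89.B5SupFactor125Torus
import Literature.MathematicalPhysics.QuantumFieldTheory.Balaban1983to89.B5Prop12GHolds

namespace Literature.MathematicalPhysics.QuantumFieldTheory.Balaban1983to89.B5Eq125OfRecord

open scoped Matrix
open Literature.MathematicalPhysics.QuantumFieldTheory.Balaban1983to89
open Literature.MathematicalPhysics.QuantumFieldTheory.Balaban1983to89.B5Prop11Plancherel (Tor fine)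
open Literature.MathematicalPhysics.QuantumFieldTheory.Balaban1983to89.B5Prop12FieldsLattice (distU cutSupL holderT)
open Literature.MathematicalPhysics.QuantumFieldTheory.Balaban1983to89.B5RealFields (GR gradR divTR cplx)
open Literature.MathematicalPhysics.QuantumFieldTheory.Balaban1983to89.B5SettingP12Real (VecR)
open Literature.MathematicalPhysics.QuantumFieldTheory.Balaban1983to89.B5SiteBridgeP12 (nP MP one_le_nP)
open Literature.MathematicalPhysics.QuantumFieldTheory.Balaban1983to89.B5ResidualGpTorusHolds (TopIdx)
open Literature.MathematicalPhysics.QuantumFieldTheory.Balaban1983to89.B5Prop12GHolds (global115_117_famG_printed)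
open Literature.MathematicalPhysics.QuantumFieldTheory.Balaban1983to89.B5WalkTorusGeom (Cen)
open Literature.MathematicalPhysics.QuantumFieldTheory.Balaban1983to89.B5WalkCarrierTorus (Bnd)
open Literature.MathematicalPhysics.QuantumFieldTheory.Balaban1983to89.B5WalkH128Torus (gz)
open Literature.MathematicalPhysics.QuantumFieldTheory.Balaban1983to89.B5SupHolderTorus (holS)
open Literature.MathematicalPhysics.QuantumFieldTheory.Balaban1983to89.B5SupFactor125Torus (cFH cLT c1H quotH_gz_G_le abs_gz_G_le
  last_vec_le last_ten_le one_quotH_ten_le)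

noncomputable section

variable {d L : ℕ} {a : ℝ}

/-! ## §1 (1.125) of record -/

/-- **(1.125) AS PRINTED, HYPOTHESIS-FREE FOR THE G-FAMILY OF RECORD, READ AT A PAIR**: uniform `C > 0`, `C_α` with, for every member `i`,
`M₀ ≥ 1`, centre `z`, real field `B`, `0 ≤ α < 1`, cut-off `ζ`, indices `ν, μ`, pair `0 < |x − x′| ≤ 1`:
`|ζ(x′)(∇_ν h_zGB)_μ(x′) − ζ(x)(∇_ν h_zGB)_μ(x)| ≤ cFH·(C + |C_α(α)|)·(‖ζ‖_α + |ζ|)·‖B‖·|x − x′|^α` («‖ζ∇h_zGh_zA‖_α ≤ O(1)(‖ζ‖_α + |ζ|)|h_zA|»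
with `B = h_zA`). [cite: Balaban1984PropagatorsI, (1.125) p.38, (1.115) p.36] -/
theorem eq125_of_record (hd : 1 ≤ d) (hL : Odd L ∧ 1 < L) (ha : 0 < a) :
    ∃ C : ℝ, ∃ Cα : ℝ → ℝ, 0 < C ∧ ∀ (i : TopIdx d L) (M₀ : ℕ), 1 ≤ M₀ →
      ∀ (z : Cen (MP i.P) M₀) (B : VecR (nP i.P) (MP i.P)) (α : ℝ), 0 ≤ α → α < 1 →
      ∀ (ζ : Tor (fine (nP i.P) (MP i.P)) → ℝ) (ν μ : Fin i.P.d) (x x' : Tor (fine (nP i.P) (MP i.P))),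
        distU (nP i.P) (MP i.P) x x' ≤ 1 → 0 < distU (nP i.P) (MP i.P) x x' →
        |ζ x' * gradR (nP i.P) (MP i.P) (fun b' => gz (nP i.P) (MP i.P) M₀ z b' * (GR (nP i.P) (MP i.P) a *ᵥ B) b') ν (x', μ)
            - ζ x * gradR (nP i.P) (MP i.P) (fun b' => gz (nP i.P) (MP i.P) M₀ z b' * (GR (nP i.P) (MP i.P) a *ᵥ B) b') ν (x, μ)|
          ≤ cFH d * (C + |Cα α|) * (holS (nP i.P) (MP i.P) α ζ + cutSupL (nP i.P) (MP i.P) ζ) * ‖B‖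
              * distU (nP i.P) (MP i.P) x x' ^ α := by
  obtain ⟨C, Cα, Cε, Cαε, hC, hG⟩ := global115_117_famG_printed hd hL ha
  refine ⟨C, Cα, hC, ?_⟩
  rintro ⟨P, hPd, hPL, hK⟩ M₀ hM₀ z B α hα0 hα1 ζ ν μ x x' h1 h0
  subst hPd
  exact quotH_gz_G_le P.K (one_le_nP P) hM₀ hC.le (hG ⟨P, rfl, hPL, hK⟩) z B hα0 hα1 ζ ν μ h1 h0

/-- **(1.125), POINT FORM, HYPOTHESIS-FREE FOR THE FAMILY OF RECORD**: `|(h_zGB)(b)| ≤ C‖B‖` for every member, `M₀`, `z`, `B`, bond `b`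
(the `|GJ|` member of (1.115) behind the evaluation entries of (1.110)). [cite: Balaban1984PropagatorsI, (1.125) p.38, (1.115) p.36] -/
theorem eq125_eval_of_record (hd : 1 ≤ d) (hL : Odd L ∧ 1 < L) (ha : 0 < a) :
    ∃ C : ℝ, 0 < C ∧ ∀ (i : TopIdx d L) (M₀ : ℕ) (z : Cen (MP i.P) M₀) (B : VecR (nP i.P) (MP i.P)) (b : Bnd (nP i.P) (MP i.P)),
      |gz (nP i.P) (MP i.P) M₀ z b * (GR (nP i.P) (MP i.P) a *ᵥ B) b| ≤ C * ‖B‖ := by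
  obtain ⟨C, Cα, Cε, Cαε, hC, hG⟩ := global115_117_famG_printed hd hL ha
  refine ⟨C, hC, ?_⟩
  rintro ⟨P, hPd, hPL, hK⟩ M₀ z B b
  subst hPd
  exact abs_gz_G_le P.K (one_le_nP P) hC.le (hG ⟨P, rfl, hPL, hK⟩) z B b

/-! ## §2 (1.129) of record -/

/-- **(1.129), VECTOR SOURCE, HYPOTHESIS-FREE FOR THE FAMILY OF RECORD**: `|∇Gh_zJ| + |Gh_zJ| ≤ 2C|J|` for every member, `M₀`, `z`, `J`.
[cite: Balaban1984PropagatorsI, (1.129) p.38, (1.115) p.36] -/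
theorem eq129_vec_of_record (hd : 1 ≤ d) (hL : Odd L ∧ 1 < L) (ha : 0 < a) :
    ∃ C : ℝ, 0 < C ∧ ∀ (i : TopIdx d L) (M₀ : ℕ) (z : Cen (MP i.P) M₀) (J : VecR (nP i.P) (MP i.P)),
      ‖gradR (nP i.P) (MP i.P) (GR (nP i.P) (MP i.P) a *ᵥ fun b => gz (nP i.P) (MP i.P) M₀ z b * J b)‖
          + ‖GR (nP i.P) (MP i.P) a *ᵥ fun b => gz (nP i.P) (MP i.P) M₀ z b * J b‖ ≤ 2 * C * ‖J‖ := by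
  obtain ⟨C, Cα, Cε, Cαε, hC, hG⟩ := global115_117_famG_printed hd hL ha
  refine ⟨C, hC, ?_⟩
  rintro ⟨P, hPd, hPL, hK⟩ M₀ z J
  subst hPd
  exact last_vec_le P.K (one_le_nP P) hC.le (hG ⟨P, rfl, hPL, hK⟩) z J

/-- **(1.129), TENSOR SOURCE, HYPOTHESIS-FREE FOR THE FAMILY OF RECORD**: uniform `C > 0`, `C_ε` with, for every member, `M₀ ≥ 1`, `z`,
real tensor field `T` and `0 < ε < 1`: `|∇Gh_z∇*T| + |Gh_z∇*T| ≤ cLT·(C + |C_ε(ε)|)·(‖T‖_ε + |T|)` («|∇Gh_z∇*J| + |Gh_z∇*J| ≤ O(1)(‖J‖_ε + |J|)»).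
[cite: Balaban1984PropagatorsI, (1.129) p.38, (1.115)–(1.116) p.36] -/
theorem eq129_ten_of_record (hd : 1 ≤ d) (hL : Odd L ∧ 1 < L) (ha : 0 < a) :
    ∃ C : ℝ, ∃ Cε : ℝ → ℝ, 0 < C ∧ ∀ (i : TopIdx d L) (M₀ : ℕ), 1 ≤ M₀ →
      ∀ (z : Cen (MP i.P) M₀) (T : Fin i.P.d → VecR (nP i.P) (MP i.P)) (ε : ℝ), 0 < ε → ε < 1 →
        ‖gradR (nP i.P) (MP i.P) (GR (nP i.P) (MP i.P) a *ᵥ fun b => gz (nP i.P) (MP i.P) M₀ z b * divTR (nP i.P) (MP i.P) T b)‖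
            + ‖GR (nP i.P) (MP i.P) a *ᵥ fun b => gz (nP i.P) (MP i.P) M₀ z b * divTR (nP i.P) (MP i.P) T b‖
          ≤ cLT d * (C + |Cε ε|) * (holderT (nP i.P) (MP i.P) ε (fun ν => cplx (T ν)) + ‖T‖) := by
  obtain ⟨C, Cα, Cε, Cαε, hC, hG⟩ := global115_117_famG_printed hd hL ha
  refine ⟨C, Cε, hC, ?_⟩
  rintro ⟨P, hPd, hPL, hK⟩ M₀ hM₀ z T ε hε0 hε1
  subst hPd
  exact last_ten_le P.K (one_le_nP P) hM₀ hC.le (hG ⟨P, rfl, hPL, hK⟩) z T hε0 hε1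

/-! ## §3 (1.130) of record -/

/-- **(1.130) AS PRINTED, HYPOTHESIS-FREE FOR THE G-FAMILY OF RECORD, READ AT A PAIR** — the one-factor terms: uniform `C > 0`, `C_α`, `C_ε`,
`C_{α,ε}` with, for every member, `M₀ ≥ 1`, `z`, real tensor field `T`, `0 ≤ α`, `0 < ε`, `α + ε < 1`, cut-off `ζ`, indices `ν, μ`, pair
`0 < |x − x′| ≤ 1`: `|ζ(x′)(∇_ν h_zGh_z∇*T)_μ(x′) − ζ(x)(∇_ν h_zGh_z∇*T)_μ(x)| ≤ c1H·(C + |C_α(α)| + |C_ε(ε)| + |C_{α,ε}(α,ε)|)·(‖ζ‖_α + |ζ|)·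
(‖T‖_{α+ε} + |T|)·|x − x′|^α` («‖ζ∇h_zGh_z∇*J‖_α ≤ O(1)(‖ζ‖_α + |ζ|)(‖J‖_{α+ε} + |J|). (1.130)»).
[cite: Balaban1984PropagatorsI, (1.130) p.38, (1.115)–(1.117) p.36] -/
theorem eq130_of_record (hd : 1 ≤ d) (hL : Odd L ∧ 1 < L) (ha : 0 < a) :
    ∃ C : ℝ, ∃ Cα Cε : ℝ → ℝ, ∃ Cαε : ℝ → ℝ → ℝ, 0 < C ∧ ∀ (i : TopIdx d L) (M₀ : ℕ), 1 ≤ M₀ →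
      ∀ (z : Cen (MP i.P) M₀) (T : Fin i.P.d → VecR (nP i.P) (MP i.P)) (α ε : ℝ), 0 ≤ α → 0 < ε → α + ε < 1 →
      ∀ (ζ : Tor (fine (nP i.P) (MP i.P)) → ℝ) (ν μ : Fin i.P.d) (x x' : Tor (fine (nP i.P) (MP i.P))),
        distU (nP i.P) (MP i.P) x x' ≤ 1 → 0 < distU (nP i.P) (MP i.P) x x' →
        |ζ x' * gradR (nP i.P) (MP i.P) (fun b' => gz (nP i.P) (MP i.P) M₀ z b' *
              (GR (nP i.P) (MP i.P) a *ᵥ fun b'' => gz (nP i.P) (MP i.P) M₀ z b'' * divTR (nP i.P) (MP i.P) T b'') b') ν (x', μ)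
          - ζ x * gradR (nP i.P) (MP i.P) (fun b' => gz (nP i.P) (MP i.P) M₀ z b' *
              (GR (nP i.P) (MP i.P) a *ᵥ fun b'' => gz (nP i.P) (MP i.P) M₀ z b'' * divTR (nP i.P) (MP i.P) T b'') b') ν (x, μ)|
          ≤ c1H d * (C + |Cα α| + |Cε ε| + |Cαε α ε|) * (holS (nP i.P) (MP i.P) α ζ + cutSupL (nP i.P) (MP i.P) ζ)
              * (holderT (nP i.P) (MP i.P) (α + ε) (fun ν => cplx (T ν)) + ‖T‖) * distU (nP i.P) (MP i.P) x x' ^ α := by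
  obtain ⟨C, Cα, Cε, Cαε, hC, hG⟩ := global115_117_famG_printed hd hL ha
  refine ⟨C, Cα, Cε, Cαε, hC, ?_⟩
  rintro ⟨P, hPd, hPL, hK⟩ M₀ hM₀ z T α ε hα0 hε0 hαε ζ ν μ x x' h1 h0
  subst hPd
  exact one_quotH_ten_le P.K (one_le_nP P) hM₀ hC.le (hG ⟨P, rfl, hPL, hK⟩) z T hα0 hε0 hαε ζ ν μ h1 h0

end

end Literature.MathematicalPhysics.QuantumFieldTheory.Balaban1983to89.B5Eq125OfRecord
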